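import Literature.MathematicalPhysics.QuantumFieldTheory.Balaban1983to89.Beta.RemainderOriginTwoLetters
import Literature.MathematicalPhysics.QuantumFieldTheory.Balaban1983to89.Beta.RemainderInvQGQCoercive

/-!
# Bałaban, *The variational problem and background fields in renormalization group method for lattice gauge
# theories*, Commun. Math. Phys. **102** (1985) 277–309 — the (190) letter of `(δ/δB)𝓗(0) = H₀ + G̃Δ⁽²⁾H₀` in a background
# FROM [5] THM 3.3 FOR `Δ_a⁻¹` AND A COERCIVITY CONSTANT OF `QG₀Q*` ALONE, the `Q`-images on a concrete real carrier

CITATION HEADER (lean-in-tree rule 2026-08-18).  Source: T. Bałaban, Commun. Math. Phys. **102** (1985) 277–309,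
doi:10.1007/BF01229381 [Balaban1985Variational] (cell paper B11 = [15]; held `paper:balaban1985-cmp102-variational-background`,
journal page = PDF page + 276): p. 297 after (128) *"For the operator Δ_a⁻¹ = G we have proved Theorem 3.3 in [5], and especially the
bounds (3.42)"*, (129)–(131) pp. 297–298, p. 306 after (179), (180), (182) p. 307, (190) p. 308; its ref. [5] = T. Bałaban, Commun.
Math. Phys. **99** (1985) 389–434 [Balaban1985BackgroundPropagators] (B9): Thm 3.3 p. 399 with (3.42) p. 397, (3.132)–(3.133) p. 422
(*"(QGQ*)^{−1} … can be analyzed in the same way … We will not repeat these considerations here"*), (3.137)–(3.138) p. 423; its ref.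
[3] = Commun. Math. Phys. **96** (1984) 223–250 [Balaban1984PropagatorsII] (B6) (2.51)–(2.56) pp. 232–233, Lemma 2.1 (2.61) p. 234;
mechanism J.-M. Combes, L. Thomas, Commun. Math. Phys. **34** (1973) 251–270 [CombesThomas1973] §II (`QGQInverse.inverse_decay`).

WHY THIS FILE (audit cell `pub-balaban`, BINDER row (D4), OWNER lineage `b2b-balaban-beta-an4`, gen 106).  The END of the gen-106
chain `Beta.RemainderInvQGQNewG` → `Beta.RemainderOriginTwoLetters` → `Beta.RemainderInvQGQCoercive`: on a carrier where the
`Q`-images are real functions on a finite index set `n` (coarse sites × colour components) with the sharp-block sup sizes of a block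
map `blk : n → 𝔅` (`B11SectG.BlockNorm.ofBlocks`, `κ = 1`) — fields, sources and B-data staying abstract block-normed spaces — the
(190) letter of NODE D at the origin, `Ineq190 bB bN (H₀ + G̃Δ⁽²⁾H₀) C δ`, follows from **ONE analytic letter `hG0`** ([5] Thm 3.3
(3.42), first entry, for `G₀ = Δ_a⁻¹` in the background) **and ONE coercivity constant `γ > 0` of the matrix of `QG₀Q*`**
(`QGQInverse.Coercive`), everything else being structure: `H₀ = G₀Q*(QG₀Q*)⁻¹J` ((129)) with `(QG₀Q*)⁻¹ := ` the matrix inverse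
(a two-sided inverse BY COERCIVITY, `QGQInverse.isUnit_of_coercive`); `Δ⁽²⁾`, `Q`, `Q*`, `J` local; the resolvent identities of the
new `G′` and of `(QG′Q*)⁻¹` with a priori bounds; `G̃ = G′ − G′Q*(QG′Q*)⁻¹QG′`; at most `N` indices per block; the pseudo-metric and
row-sum bookkeeping (2.54)/(2.61); the Combes–Thomas rates `κ + τ + σ ≤ δ₁` with `ρ_S = C_Sκτ⁻¹Nc < γ` (the (3.132) rate `κ` born
here); and two smallnesses `q, q_I < 1` linear in the (3.137) factor `λ`.
* **`ineq190_origin_of_coercive`** — the composition: `hInv₀ := RemainderInvQGQCoercive.hasMaj_invQGQ_of_coercive` into `RemainderOriginTwoLetters.ineq190_origin_of_two_letters` with `bQ = bQ′ = ofBlocks`, `B_I = N(γ − ρ_S)⁻¹`,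
  `δ_I = κ`; every constant bound to its closed form by a `h…` hypothesis (instantiate with `rfl`).
LETTER LIST OF NODE D AT THE ORIGIN IN A BACKGROUND after this file (analytic): [5] Thm 3.3 (3.42)₀ for the BOND operator
`Δ_a = Δ_U + DRD* + Q*Q` in the background (tree: `B9.Thm33Printed`, statement; flat `U = 1`: `B5DeltaA169`, `Beta.DeltaACombesThomas*`
modulo (1.126); background: the NE9 programme treats Thm 3.1's SITE operator) + the coercivity of `QΔ_a⁻¹Q*` (r1's written repair
`QGQ-inverse-proof.md`, Lemma P′: an ENERGY bound for block-constant transported test fields through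
`QGQInverse.qgq_coercive_of_approx_right_inverse` — an UPPER bound on `Δ_a`, no inverse; flat analogue for the site operator:
`B6QGQLower276.qGq_lower`).  Both are statements about Bałaban's one-step bond operator, whose Lean carrier is NODE O.

HONEST SCOPE.  Plumbing only ([folklore] composition of the three siblings); NO estimate of [5] or [15] is proved; nothing identifies
Bałaban's step-`k` operators with tree terms (NODE O); single-scale ∕ unweighted `Q`-sizes (the (3.132) weights not reproduced);
constants and rates are this file's.  Row (D4) class UNCHANGED (instance 0∕1; D4 DISCHARGE NO DATE); NOT B12 Thm 2, NOT BetaPertH, NOT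
continuum, NOT Clay.  HONEST DEPENDENCY (cell line): continuum YM on T⁴ ⇐ BetaPertH ∧ nine spine estimates (0/9 proved); BetaPertH ⇐
(D1) ∧ (D4) ∧ CAP+tail; G-an2-4 gates asym, D1 and NE2/3/4.  NEW file; nothing modified; 0 `def`; standard axioms; no `sorry`.
-/

namespace Literature.MathematicalPhysics.QuantumFieldTheory.Balaban1983to89.Beta.RemainderOriginCoercive

open Literature.MathematicalPhysics.QuantumFieldTheory.Balaban1983to89
open Finset B6RandomWalk B11SectG B11Reparam190
open Beta.RemainderOriginTwoLetters Beta.RemainderInvQGQCoercive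

variable {g : B6.Geometry}

variable {n : Type} [Fintype n] [DecidableEq n]
  {FB FA F3 : Type} [AddCommGroup FB] [Module ℝ FB] [AddCommGroup FA] [Module ℝ FA]
  [AddCommGroup F3] [Module ℝ F3]

/-- **NODE D OF ROW (D4) AT THE ORIGIN, IN A BACKGROUND, FROM [5] THM 3.3 FOR `Δ_a⁻¹` AND THE COERCIVITY OF `QG₀Q*`.**  `Q`-images
= real functions on the finite index set `n` with the sharp-block sup sizes of `blk : n → 𝔅` (at most `N` indices per block); fields
`FA` (size `bN`), sources `F3` (size `b3`), B-data `FB` (size `bB`) abstract.  ANALYTIC INPUTS: `hG0` — `G₀ : F3 → FA` of majorant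
`Be^{−δ₁d}` ([5] Thm 3.3 (3.42), first entry, for `Δ_a⁻¹`; p. 297 of [15]); `hco` — the matrix `S` of `QG₀Q*` is `γ`-coercive
(`γ > ρ_S ≥ 0`).  STRUCTURE: `Q : FA → (n → ℝ)`, `Q* : (n → ℝ) → F3`, `J : FB → (n → ℝ)`, `Δ⁽²⁾ : FA → F3` LOCAL (ranges `r_Q`, `r_J`, `r_D`;
row ∕ column sums `ν_Q`, `ν_{Q*}`, `ν_J`, `λ`); `H₀ = G₀Q*·S⁻¹·J` ((129), `S⁻¹` the matrix inverse — a two-sided inverse by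
coercivity, `QGQInverse.isUnit_of_coercive`, though the bound below does not even use that); `G′ = G₀ + G₀Δ⁽²⁾G′` a priori bounded
(p. 306); `Inv′ = S⁻¹ − S⁻¹·(Q·G₀Δ⁽²⁾G′·Q*)·Inv′` a priori bounded (the second resolvent identity — it holds for `Inv′ = (QG′Q*)⁻¹` by
`RemainderInvQGQNewG.inv_fix_of_perturbation` + `qgq_newG_eq` from `S⁻¹S = 1`, `QG′Q*·Inv′ = 1`); `G̃ = G′ − G′Q*·Inv′·QG′` ((131)/(180)); the distance of `𝔅` a pseudo-metric with (2.54) and the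
row sum (2.61) at the rate `σ ≥ 0`, constant `c ≥ 0`; RATES: `κ ≥ 0`, `τ > 0`, `κ + τ + σ ≤ δ₁` (Combes–Thomas), `ρ + 5σ ≤ κ`
(so `ρ + 5σ ≤ δ₁`), `δ/8 ≤ ρ`; SMALLNESSES: `ρ_S = C_Sκτ⁻¹Nc < γ` (`C_S = κ₃κ_NBν_Qν_{Q*}e^{2δ₁r_Q}`, the majorant constant of
`QG₀Q*`), `q = κ_Nκ₃Bλe^{δ₁r_D}c < 1`, `q_I = B_Iθ_Pc² < 1` (`B_I = N(γ − ρ_S)⁻¹`).  CONCLUSION: `Ineq190 bB bN (H₀ + G̃Δ⁽²⁾H₀)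
(A₀ + κ₃B_G̃θ_Dc) δ` with the constants of `RemainderOriginTwoLetters.ineq190_origin_of_two_letters` at `κ_Q = κ_{Q′} = 1`,
`B_I = N(γ − ρ_S)⁻¹`, `δ_I = κ` — all bound to closed forms by the `h…` hypotheses (instantiate with `rfl`).
[cite: Balaban1985Variational, (129)–(131) pp.297–298, p.306 after (179), (180) p.306, (182) p.307, (190) p.308; Balaban1985BackgroundPropagators, Thm 3.3 (3.42) p.397+p.399, (3.132)–(3.133) p.422, (3.137)–(3.138) p.423; Balaban1984PropagatorsII, (2.51)–(2.54) pp.232–233, Lemma 2.1 (2.61) p.234; CombesThomas1973, §II] -/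
theorem ineq190_origin_of_coercive (blk : n → g.Site)
    {bB : BlockNorm g FB} {bN : BlockNorm g FA} {b3 : BlockNorm g F3}
    {H0 : FB →ₗ[ℝ] FA} {D2 : FA →ₗ[ℝ] F3} {G0 G' Gt : F3 →ₗ[ℝ] FA} {Q : FA →ₗ[ℝ] (n → ℝ)} {Qs : (n → ℝ) →ₗ[ℝ] F3}
    {Inv' : (n → ℝ) →ₗ[ℝ] (n → ℝ)} {J : FB →ₗ[ℝ] (n → ℝ)} {S : Matrix n n ℝ} {KD KQ KQs KJ : g.Site → g.Site → ℝ}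
    {N : ℕ} {γ B δ₁ κ τ ρS CS BI M₀ MI lam rD νQ νs rQ νJ rJ ρ σ c A₀ θD q BG' θP qI BI' BGt δ : ℝ}
    -- geometry
    (htri : Triangle254 g) (hd : ∀ a b : g.Site, 0 ≤ g.dist a b) (hds : ∀ a b : g.Site, g.dist a b = g.dist b a)
    (hd0 : ∀ a : g.Site, g.dist a a = 0) (hrow : RowSum g σ c) (hc : 0 ≤ c)
    (hN : ∀ y : g.Site, ∃ s : Finset n, s.card ≤ N ∧ ∀ j, blk j = y → j ∈ s)
    -- rates
    (hσ : 0 ≤ σ) (hρ : 0 ≤ ρ) (hκ : 0 ≤ κ) (hτ : 0 < τ) (hrate : κ + τ + σ ≤ δ₁) (hρκ : ρ + 5 * σ ≤ κ) (hδ : δ / 8 ≤ ρ)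
    (hB : 0 ≤ B) (hM₀ : 0 ≤ M₀) (hMI : 0 ≤ MI) (hlam : 0 ≤ lam) (hνQ : 0 ≤ νQ) (hνs : 0 ≤ νs) (hνJ : 0 ≤ νJ)
    -- THE analytic letter: Thm 3.3 (3.42), first entry, for G₀ = Δ_a⁻¹
    (hG0 : HasMaj b3 bN G0 (fun a b => B * Real.exp (-(δ₁ * g.dist a b))))
    -- THE coercivity of S = the matrix of QG₀Q*
    (hSdef : S = LinearMap.toMatrix' ((Q ∘ₗ G0) ∘ₗ Qs)) (hco : QGQInverse.Coercive S γ)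
    (hCS : CS = b3.κ * (bN.κ * B * νQ * Real.exp (δ₁ * rQ)) * νs * Real.exp (δ₁ * rQ))
    (hρS : ρS = CS * κ / τ * N * c) (hρSγ : ρS < γ) (hBI : BI = N * (γ - ρS)⁻¹)
    -- H₀ = G₀Q*(QG₀Q*)⁻¹J with J local
    (hH0def : H0 = ((G0 ∘ₗ Qs) ∘ₗ Matrix.toLin' S⁻¹) ∘ₗ J)
    (hKJ : ∀ a b, 0 ≤ KJ a b) (hJloc : ∀ a b, KJ a b ≠ 0 → g.dist a b ≤ rJ)
    (hJcol : ∀ b, ∑ a : g.Site, KJ a b ≤ νJ) (hJ : HasMaj bB (BlockNorm.ofBlocks g blk) J KJ)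
    -- Δ⁽²⁾ local
    (hKD : ∀ a b, 0 ≤ KD a b) (hDloc : ∀ a b, KD a b ≠ 0 → g.dist a b ≤ rD)
    (hDrow : ∀ a, ∑ b : g.Site, KD a b ≤ lam) (hDcol : ∀ b, ∑ a : g.Site, KD a b ≤ lam)
    (hD2 : HasMaj bN b3 D2 KD)
    -- the new G′
    (hfix : G' = G0 + (G0 ∘ₗ D2) ∘ₗ G') (hap : HasMaj b3 bN G' (fun _ _ => M₀))
    (hq_def : q = bN.κ * (b3.κ * B * lam * Real.exp (δ₁ * rD)) * c) (hq : q < 1) (hBG' : BG' = B * (1 - q)⁻¹)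
    -- Q, Q* local
    (hKQ : ∀ a b, 0 ≤ KQ a b) (hQloc : ∀ a b, KQ a b ≠ 0 → g.dist a b ≤ rQ)
    (hQrow : ∀ a, ∑ b : g.Site, KQ a b ≤ νQ) (hQ : HasMaj bN (BlockNorm.ofBlocks g blk) Q KQ)
    (hKQs : ∀ a b, 0 ≤ KQs a b) (hQsloc : ∀ a b, KQs a b ≠ 0 → g.dist a b ≤ rQ)
    (hQscol : ∀ b, ∑ a : g.Site, KQs a b ≤ νs) (hQs : HasMaj (BlockNorm.ofBlocks g blk) b3 Qs KQs)
    -- (QG′Q*)⁻¹: second resolvent identity, a priori bound, smallness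
    (hfixI : Inv' = Matrix.toLin' S⁻¹ -
      (Matrix.toLin' S⁻¹ ∘ₗ (Q ∘ₗ (((G0 ∘ₗ D2) ∘ₗ G') ∘ₗ Qs))) ∘ₗ Inv')
    (hapI : HasMaj (BlockNorm.ofBlocks g blk) (BlockNorm.ofBlocks g blk) Inv' (fun _ _ => MI))
    (hθP : θP = bN.κ * (b3.κ * (bN.κ * (b3.κ * B * lam * Real.exp (δ₁ * rD)) * BG' * c) * νs *
      Real.exp ((ρ + 4 * σ) * rQ)) * νQ * Real.exp ((ρ + 4 * σ) * rQ))
    (hqI : qI = BI * θP * c * c) (hqI1 : qI < 1) (hBI' : BI' = BI * (1 - qI)⁻¹)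
    -- G̃ = G′P₀′*
    (hGt : Gt = G' - (G' ∘ₗ Qs) ∘ₗ Inv' ∘ₗ (Q ∘ₗ G'))
    -- derived constants
    (hA₀ : A₀ = (b3.κ * B * νs * Real.exp (δ₁ * rQ)) * (BI * νJ * Real.exp (κ * rJ)) * c)
    (hθD : θD = bN.κ * A₀ * lam * Real.exp (ρ * rD))
    (hBGt : BGt = BG' + bN.κ * b3.κ * νQ * νs * BI' * BG' * BG' *
      Real.exp ((ρ + 2 * σ) * rQ) * Real.exp ((ρ + 2 * σ) * rQ) * c * c) :
    Ineq190 bB bN (H0 + Gt ∘ₗ (D2 ∘ₗ H0)) (A₀ + b3.κ * BGt * θD * c) δ := by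
  -- hInv₀ from hG0 + coercivity (RemainderInvQGQCoercive §5): S⁻¹ has the majorant BI·e^{−κd}
  have hInv0 : HasMaj (BlockNorm.ofBlocks g blk) (BlockNorm.ofBlocks g blk) (Matrix.toLin' S⁻¹)
      (fun a b => BI * Real.exp (-(κ * g.dist a b))) := by
    rw [hBI]
    exact hasMaj_invQGQ_of_coercive blk hd hds hd0 htri hrow hB hνQ hνs hκ hτ hσ hrate hN hG0 hKQ hQloc hQrow hQ hKQs
      hQsloc hQscol hQs hSdef hco hCS hρS hρSγ
  have hBI0 : 0 ≤ BI := by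
    rw [hBI]; exact mul_nonneg (Nat.cast_nonneg N) (inv_nonneg.mpr (by linarith))
  -- the two-letter END with bQ = bQ′ = the sharp-block sup sizes (κ = 1), δ_I = κ
  have hκ1 : (BlockNorm.ofBlocks g blk : BlockNorm g (n → ℝ)).κ = 1 := rfl
  refine ineq190_origin_of_two_letters (bQ := BlockNorm.ofBlocks g blk) (bQ' := BlockNorm.ofBlocks g blk) htri hd hrow hc hσ hρ
    (by linarith) hρκ hδ hB hBI0 hM₀ hMI hlam hνQ hνs hνJ hG0 hInv0 hH0def hKJ hJloc hJcol hJ hKD hDloc hDrow hDcol hD2 hfix hap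
    hq_def hq hBG' hKQ hQloc hQrow hQ hKQs hQsloc hQscol hQs hfixI hapI hθP ?_ hqI1 hBI' hGt ?_ hθD ?_
  · rw [hqI, hκ1]; ring
  · rw [hA₀, hκ1]; ring
  · rw [hBGt, hκ1]; ring

end Literature.MathematicalPhysics.QuantumFieldTheory.Balaban1983to89.Beta.RemainderOriginCoercive
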